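import Literature.IUT.LogVolume.Corollary22Thm110LegendreWitness
import HarnessLib

/-!
# [IUTchIV] Cor. 2.2 (ii): the antecedent of `Cor22.Thm110Legendre` is satisfiable WITH THE PRIME `l` IN THE
# (P1) WINDOW `h^{1/2} ≤ l ≤ 10δ·h^{1/2}·log(2δ·h)` — non-vacuity exactly where the proof consumes Thm 1.10

S. Mochizuki, *Inter-universal Teichmüller theory IV*, RIMS manuscript (Apr. 2020) = PRIMS **57** (2021),
Cor. 2.2 (ii), proof (P1)–(P7) pp. 45–46 [claim: Mochizuki2012, status: disputed] (claim key, D-0012; the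
content of THIS file is classical arithmetic of the `λ`-line plus the tree's Chebyshev bookkeeping).

Proof-only sequel (cell abc-iut, layer S support; abc-iut-w5-d054 g2, closing INFO-1 of its audit of
`Corollary22Thm110LegendreWitness.lean`): that file inhabits the antecedent of the Theorem-1.10 interface
`Cor22.Thm110Legendre` at `λ`-line points of unbounded `h = log(q^∀)` with a prime `l > [F:ℚ]·h/log 2` — a
prime OUTSIDE the window (P1) `h^{1/2} ≤ l ≤ 10δ·h^{1/2}·log(2δ·h)` in which the proof of Cor. 2.2 (ii)
actually applies Thm 1.10.  Here the prime is taken INSIDE that window, from the tree's (P1)(P2)(P3)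
prime-selection `Cor22.exists_prime_P1_P2_P3_point` (abc-iut S chain; Chebyshev `θ` bounds via `IsXiPrm`):

* `Cor22.exists_thm110Legendre_antecedent_window` — ∀ `H` ∃ `η, P, l`: `IsEtaPrm η`, `P ∈ UP ∩ K_V ∩ U^{≤1}`
  (`K_V = CBData.std {2}`), `l` prime, `7 ≤ l`, `AdmitsCore P`, `CondP2/CondP5/CondP6 P l`, `H < h(P)`, AND
  `h(P)^{1/2} ≤ l ≤ 10δ₁·h(P)^{1/2}·log(2δ₁·h(P))` (`δ₁ = delta 1 = 2^{12}·3^3·5`);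
* `Cor22.exists_display_of_thm110Legendre_window` — hence `Thm110Legendre` forces the Thm-1.10 display at such
  `(P, l)`: the interface is exercised precisely in the regime of (P1).

No definitions, no new named fact; nothing here bears on the disputed [IUTchIII] Cor. 3.12 or asserts
`Thm110Legendre`; typed ≠ proved.
-/

noncomputable section

namespace Literature.IUT.LogVolume

namespace Cor22

open NumberField IsDedekindDomain
open Literature.NumberTheory.DiophantineGeometry Literature.NumberTheory.DiophantineGeometry.GenEll

/-- **NON-VACUITY of the antecedent of `Cor22.Thm110Legendre` INSIDE the (P1) window.**  For every `H`
there are `η, P, l` with `IsEtaPrm η`, `P ∈ UP ∩ K_V ∩ U_X(ℚ̄)^{≤1}` (`K_V = CBData.std {2}`), `l` prime,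
`7 ≤ l`, `AdmitsCore P`, (P2) `CondP2 P l`, (P5) `CondP5 P l`, (P6) `CondP6 P l`, `H < log(q^∀(P))`, and the
(P1) bounds `log(q^∀(P))^{1/2} ≤ l ≤ 10δ₁·log(q^∀(P))^{1/2}·log(2δ₁·log(q^∀(P)))`, `δ₁ = delta 1` — the prime
now comes from the Chebyshev prime-selection `exists_prime_P1_P2_P3_point` of the S chain, the point from
`exists_ratPoint_mem_std_two` (`λ_k = 1/2 + 2/7^k`). [cite: Mochizuki2012, IUTchIV Cor 2.2 (ii) proof (P1)-(P7) pp.45-46] -/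
theorem exists_thm110Legendre_antecedent_window (H : ℝ) :
    ∃ (η : ℝ) (P : NFPoint) (l : ℕ), IsEtaPrm η ∧ P ∈ UP ∧
      P ∈ (CBData.std {2} (by simp [Nat.prime_two])).toSet ∧ P ∈ UPle 1 ∧
      l.Prime ∧ 7 ≤ l ∧ AdmitsCore P ∧ CondP2 P l ∧ CondP5 P l ∧ CondP6 P l ∧ H < logQForall P ∧
      Real.sqrt (logQForall P) ≤ l ∧
      (l : ℝ) ≤ 10 * delta 1 * Real.sqrt (logQForall P) * Real.log (2 * delta 1 * logQForall P) := by
  have hS : ∀ p ∈ ({2} : Finset ℕ), p.Prime := by simp [Nat.prime_two]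
  obtain ⟨η, hη⟩ := exists_isEtaPrm
  obtain ⟨ξ, hξ⟩ := exists_isXiPrm
  obtain ⟨HK, hHK⟩ := condP6_of_seven_le (CBData.std {2} hS)
  obtain ⟨q, hmem, hU1, hcore, hbig, hneg⟩ :=
    exists_ratPoint_mem_std_two hS (max (max H HK) (max (ξ ^ 2) 64))
  have hH : H < logQForall (ratPoint q) :=
    lt_of_le_of_lt ((le_max_left _ _).trans (le_max_left _ _)) hbig
  have hHK' : HK < logQForall (ratPoint q) :=
    lt_of_le_of_lt ((le_max_right _ _).trans (le_max_left _ _)) hbig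
  have hξ2 : ξ ^ 2 < logQForall (ratPoint q) :=
    lt_of_le_of_lt ((le_max_left _ _).trans (le_max_right _ _)) hbig
  have h64 : (64 : ℝ) < logQForall (ratPoint q) :=
    lt_of_le_of_lt ((le_max_right _ _).trans (le_max_right _ _)) hbig
  have hξ0 : 0 ≤ ξ := le_trans (by norm_num) hξ.1
  have hξh : ξ ≤ Real.sqrt (logQForall (ratPoint q)) := by
    rw [← Real.sqrt_sq hξ0]
    exact Real.sqrt_le_sqrt hξ2.le
  have hUP : ratPoint q ∈ UP := UPle_subset_UP 1 hU1
  have hdeg : (ratPoint q).degree ≤ 1 := (degree_ratPoint q).le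
  obtain ⟨l, hlp, hP1lo, hP1hi, hP2, -⟩ := exists_prime_P1_P2_P3_point (ratPoint q) hdeg hξ hξh
  -- `l > 8`, from `log(q^∀) > 64`
  have h8 : (8 : ℝ) < Real.sqrt (logQForall (ratPoint q)) := by
    rw [show (8 : ℝ) = Real.sqrt (8 ^ 2) by rw [Real.sqrt_sq (by norm_num)]]
    exact Real.sqrt_lt_sqrt (by norm_num) (by norm_num; exact h64)
  have hl9 : 9 ≤ l := by
    have : (8 : ℝ) < l := h8.trans_le hP1lo
    exact_mod_cast this
  have hl7 : 7 ≤ l := by omega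
  -- (P5) at the place of `ℚ` over `7`
  have hP5 : CondP5 (ratPoint q) l := by
    let v : HeightOneSpectrum (𝓞 ℚ) := (Rat.HeightOneSpectrum.primesEquiv (R := 𝓞 ℚ)).symm ⟨7, by norm_num⟩
    have hv : Rat.HeightOneSpectrum.natGenerator v = 7 :=
      congrArg Subtype.val ((Rat.HeightOneSpectrum.primesEquiv (R := 𝓞 ℚ)).apply_symm_apply ⟨7, by norm_num⟩)
    refine ⟨v, hneg v hv, ?_, ?_⟩
    · change ¬ ((2 : ℕ) : 𝓞 ℚ) ∈ v.asIdeal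
      rw [UniformABCConjecture.natCast_mem_asIdeal_iff, hv]; norm_num
    · change ¬ ((l : ℕ) : 𝓞 ℚ) ∈ v.asIdeal
      rw [UniformABCConjecture.natCast_mem_asIdeal_iff, hv]
      intro h
      have : 7 = l := (Nat.prime_dvd_prime_iff_eq (by norm_num) hlp).1 h
      omega
  have hP6 : CondP6 (ratPoint q) l := hHK (ratPoint q) hmem hUP l hlp hl7 hP2 hP5 hHK'
  exact ⟨η, ratPoint q, l, hη, hUP, hmem, hU1, hlp, hl7, hcore, hP2, hP5, hP6, hH, hP1lo, hP1hi⟩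

/-- **`Thm110Legendre` is exercised INSIDE the (P1) window**: under it, for every `H` some `λ`-line point
`P ∈ K_V ∩ U_X(ℚ̄)^{≤1}` with `log(q^∀(P)) > H` and some prime `l ≥ 7` with
`log(q^∀)^{1/2} ≤ l ≤ 10δ₁·log(q^∀)^{1/2}·log(2δ₁·log(q^∀))` carry the Theorem-1.10 display `Cor22.Display P l η`.
Nothing is asserted: `Thm110Legendre` is the hypothesis. [cite: Mochizuki2012, IUTchIV Cor 2.2 (ii) proof p.46] -/
theorem exists_display_of_thm110Legendre_window (h110 : Thm110Legendre) (H : ℝ) :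
    ∃ (η : ℝ) (P : NFPoint) (l : ℕ), IsEtaPrm η ∧ P ∈ (CBData.std {2} (by simp [Nat.prime_two])).toSet ∧
      P ∈ UPle 1 ∧ l.Prime ∧ 7 ≤ l ∧ H < logQForall P ∧
      Real.sqrt (logQForall P) ≤ l ∧
      (l : ℝ) ≤ 10 * delta 1 * Real.sqrt (logQForall P) * Real.log (2 * delta 1 * logQForall P) ∧
      Display P l η := by
  obtain ⟨η, P, l, hη, hUP, hmem, hU1, hlp, hl7, hcore, hP2, hP5, hP6, hH, hlo, hhi⟩ :=
    exists_thm110Legendre_antecedent_window H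
  exact ⟨η, P, l, hη, hmem, hU1, hlp, hl7, hH, hlo, hhi,
    h110 η hη P hUP l hlp (le_trans (by norm_num) hl7) hcore hP2 hP5 hP6⟩

end Cor22

end Literature.IUT.LogVolume
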